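/-
Copyright: the b2b-balaban T⁴-continuum CRUX team, row NE7b OWNER lineage `t4-ne7b-p1` (gen 140). Project licence.
-/
import Summits.QuantumFields.BalabanUV.T4Continuum.Spine.NE7b.SupWhitenedHessianGradientCovariance
import Summits.QuantumFields.BalabanUV.T4Continuum.Spine.NE7b.SupBlockThirdKernelAverage

/-!
# THE THIRD TWO-POINT PIECE OF `∂³W`'S KERNEL LETTER: `Σ_{y,z}|Cov_ν(U′[e_x], U″[e_y,e_z])|` FOR A GENERAL `Γ = AAᵀ` (SCOPING (d12)(1)(ii),
# completing (469)).  In `∂³W = ⟨U‴⟩ − (A_k−a_k)B_hl − B_hk(A_l−a_l) − (A_h−a_h)B_kl + κ₃` at `(h,k,l) = (e_x,e_y,e_z)` two of the covariance terms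
# pair a Hessian entry carrying the ROW index `x` with a gradient component ((469), summed over the other two indices), but the third pairs
# the GRADIENT component at `x` with the Hessian entry `U″[e_y,e_z]` carrying BOTH summed indices: (447) with `F = U′(Aξ+ψ)(e_x)` (vector
# `a^x`) against the FAMILY `U″(Aξ+ψ)(e_y)(e_z)` over the pair index `(y,z) ∈ ι × ι` (vectors `g^{yz}_w = Σ_u|A_{uw}|K3_{yzu}`, (469)), whose
# COLUMN letter is `Σ_{y,z}Σ_u|A_{uw}|K3_{yzu} ≤ αc·k3c` (`k3c` the third majorant's letter over its first two indices), gives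
#   `Σ_y Σ_z |Cov_ν(F_x, G_{yz})| ≤ (hr·αr)·(αc·k3c)·(1−γ)⁻¹(1−γ′)⁻¹∕(1−lamA)`   under `N(0,AAᵀ)`, smallness only, uniformly in `ψ` and the volume
# (row NE7b, node U5c; (447), (448), (456)–(458), (469), (470) `pair_sum_eq` BY NAME; [folklore])

Cell `pub-balaban`, sub-cell `t4`, spine estimate NE7b (`T4WeightBudget.RelWeightBound`; the cell's OWN estimate — NOT PRINTED in
[Bałaban 1983–89], NOT PROVED).  Crux-route work under `Spine/NE7b/` by the row OWNER (`t4-ne7b-p1` gen 140, file (473)) under FREEZE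
(0)'s crux-prover clause; NOTHING of Bałaban's is named as a Lean object, valued or asserted; no `T4Continuum/Support` leaf typed; no
`def`, no notation; zero `sorry`.  Imports (BY NAME): the OWNER's (469) `…SupWhitenedHessianGradientCovariance` (`hessian_obs_lipVec`; through it
(458), (457), (456), (447), (448)), (470) `…SupBlockThirdKernelAverage` (`pair_sum_eq`).

WHAT IS PROVED ([folklore]):
* §1 `hessian_family_colsum_le` (`Σ_{(y,z)}Σ_u|A_{uw}|K3_{yzu} ≤ αc·k3c`).
* §2 **`whitened_gradhess_cov_raw`** (the pair sum in the whitened Gibbs format, Neumann `D`).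
* §3 THE END **`whitened_gradhess_cov_kernel_letter`** (the double sum under `N(0,AAᵀ)`, moment letters discharged).

HONEST (what this is NOT).  The last two-point piece; with (468)∕(469)∕(470)∕(472) every piece of `∂³W`'s kernel letter for general `Γ = AAᵀ`
is typed — the ASSEMBLY (split of (472)'s centred display into the five integrals and the bridge of (468) to `N(0,AAᵀ)`) is the successor's.
Scalar skeleton ((A3), NC-NE7b-α UNRULED); nothing of Bałaban's asserted.  BY-NAME EFFECT ON THE WALL: NONE.  NE7b NOT PRINTED ∕ NOT PROVED;
spine PROVED 0∕9; rung (B)+1 — the programme's measures remain FINITE-torus statements; NOT the mass gap, NOT Clay.  HONEST DEPENDENCY: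
continuum YM on T⁴ ⇐ BetaPertH ∧ nine spine estimates (0∕9 proved); BetaPertH ⇐ (D1) ∧ (D4) ∧ CAP+tail; G-an2-4 gates asym, D1 and NE2∕3∕4.
-/

set_option autoImplicit false
set_option maxSynthPendingDepth 3

noncomputable section

namespace Summit.QuantumFields.BalabanUV.T4Continuum.NE7b.SupWhitenedGradientHessianCovariance

open MeasureTheory ProbabilityTheory Real Set Function Finset Matrix
open scoped BigOperators
open Literature.Probability.Distributions (matrixCLM)
open SupWhitenedMomentLetters (whitened_exp_integrable whitened_second_moment_integrable)
open SupWhitenedCovarianceKernelLetter (whitenedV_hasDerivAt whitenedV_floor whitenedV_ceiling whitenedV_cross whitenedV_continuous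
  whitened_integrable_lebesgue whitened_tilted_eq_gauss whitened_integral_eq)
open SupWhitenedFirstOrderLetters (whitened_obs_lipVec whitened_cross_nonneg whitened_J_rowsum_le whitened_J_colsum_le whitened_obs_nonneg
  whitened_obs_rowsum_le whitened_obs_colsum_le)
open SupWhitenedHessianGradientCovariance (hessian_obs_lipVec)
open SupBlockThirdKernelAverage (pair_sum_eq)
open SupDobrushinCovarianceGibbs (cov_rowsum_le_gibbs)
open SupDobrushinNeumannMatrix (neumann_nonneg neumann_dominates neumann_rowsum_le neumann_colsum_le)

variable {ι κ : Type} [Fintype ι] [DecidableEq ι] [Fintype κ] [DecidableEq κ]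

variable {U : EuclideanSpace ℝ ι → ℝ} {U' : EuclideanSpace ℝ ι → EuclideanSpace ℝ ι →L[ℝ] ℝ}
  {U'' : EuclideanSpace ℝ ι → EuclideanSpace ℝ ι →L[ℝ] EuclideanSpace ℝ ι →L[ℝ] ℝ}
  {U₃ : EuclideanSpace ℝ ι → EuclideanSpace ℝ ι →L[ℝ] EuclideanSpace ℝ ι →L[ℝ] EuclideanSpace ℝ ι →L[ℝ] ℝ} {Hk : ι → ι → ℝ} {K3 : ι → ι → ι → ℝ}
  {A : Matrix ι κ ℝ} {ψ : EuclideanSpace ℝ ι} {γop κ₀ κ₁ κ₂ a τ δ θ αr αc hr hc k3c lamA γ γ' : ℝ}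

/-! ## §1. The column letter of the Hessian-entry family over the pair index -/

omit [DecidableEq ι] [Fintype κ] [DecidableEq κ] in
/-- **`Σ_{(y,z)}Σ_u|A_{uw}|K3_{yzu} ≤ αc·k3c`** for `Σ_yΣ_zK3_{yzu} ≤ k3c` (all `u`), `K3 ≥ 0` (`ι` inhabited). [folklore] -/
theorem hessian_family_colsum_le [Nonempty ι] (hK30 : ∀ x y u, 0 ≤ K3 x y u) (hαc : ∀ w, ∑ u, |A u w| ≤ αc) (hk3c : ∀ u, ∑ y, ∑ z, K3 y z u ≤ k3c)
    (w : κ) : ∑ p ∈ (Finset.univ : Finset (ι × ι)), ∑ u, |A u w| * K3 p.1 p.2 u ≤ αc * k3c := by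
  obtain ⟨u₀⟩ := ‹Nonempty ι›
  have hk3c0 : 0 ≤ k3c := le_trans (Finset.sum_nonneg fun y _ => Finset.sum_nonneg fun z _ => hK30 y z u₀) (hk3c u₀)
  rw [pair_sum_eq (fun y z => ∑ u, |A u w| * K3 y z u)]
  calc ∑ y, ∑ z, ∑ u, |A u w| * K3 y z u = ∑ y, ∑ u, ∑ z, |A u w| * K3 y z u := Finset.sum_congr rfl fun y _ => Finset.sum_comm
    _ = ∑ u, ∑ y, ∑ z, |A u w| * K3 y z u := Finset.sum_comm
    _ = ∑ u, |A u w| * ∑ y, ∑ z, K3 y z u := Finset.sum_congr rfl fun u _ => by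
        rw [Finset.mul_sum]
        exact Finset.sum_congr rfl fun y _ => by rw [Finset.mul_sum]
    _ ≤ ∑ u, |A u w| * k3c := Finset.sum_le_sum fun u _ => mul_le_mul_of_nonneg_left (hk3c u) (abs_nonneg _)
    _ ≤ αc * k3c := by rw [← Finset.sum_mul]; exact mul_le_mul_of_nonneg_right (hαc w) hk3c0

/-! ## §2. The pair sum in the whitened Gibbs format -/

/-- **THE THIRD TWO-POINT PIECE IN WHITENED COORDINATES**: `Σ_yΣ_z|Cov_ν(F_x, G_{yz})| ≤ (hr·αr)·(αc·k3c)·(1−γ)⁻¹(1−γ′)⁻¹∕(1−lamA)`. [folklore] -/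
theorem whitened_gradhess_cov_raw [Nonempty κ] (hUd : ∀ φ : EuclideanSpace ℝ ι, HasFDerivAt U (U' φ) φ)
    (hU'd : ∀ φ : EuclideanSpace ℝ ι, HasFDerivAt U' (U'' φ) φ) (hU''d : ∀ φ : EuclideanSpace ℝ ι, HasFDerivAt U'' (U₃ φ) φ)
    (hHk : ∀ (φ : EuclideanSpace ℝ ι) (x z : ι), |U'' φ (EuclideanSpace.single z (1 : ℝ)) (EuclideanSpace.single x (1 : ℝ))| ≤ Hk x z)
    (hHk0 : ∀ v u, 0 ≤ Hk v u)
    (hK3 : ∀ (φ : EuclideanSpace ℝ ι) (u x y : ι),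
      |U₃ φ (EuclideanSpace.single u (1 : ℝ)) (EuclideanSpace.single x (1 : ℝ)) (EuclideanSpace.single y (1 : ℝ))| ≤ K3 x y u)
    (hK30 : ∀ x y u, 0 ≤ K3 x y u) (A : Matrix ι κ ℝ) (ψ : EuclideanSpace ℝ ι)
    (hαr : ∀ u, ∑ w, |A u w| ≤ αr) (hαc : ∀ w, ∑ u, |A u w| ≤ αc) (hhr : ∀ v, ∑ u, Hk v u ≤ hr) (hhc : ∀ u, ∑ v, Hk v u ≤ hc)
    (hk3c : ∀ u, ∑ y, ∑ z, K3 y z u ≤ k3c)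
    (hlam : ∀ x : κ, ∑ u, ∑ v, |A u x| * |A v x| * Hk v u ≤ lamA) (hlam1 : lamA < 1)
    (hγ : αc * hr * αr / (1 - lamA) ≤ γ) (hγ1 : γ < 1) (hγ' : αc * hc * αr / (1 - lamA) ≤ γ') (hγ'1 : γ' < 1)
    (hI0 : Integrable (fun ξ : EuclideanSpace ℝ κ => exp (-U (matrixCLM A ξ + ψ))) (multivariateGaussian 0 (1 : Matrix κ κ ℝ)))
    (hI2 : ∀ w, Integrable (fun ξ : EuclideanSpace ℝ κ => exp (-U (matrixCLM A ξ + ψ)) * ξ w ^ 2) (multivariateGaussian 0 (1 : Matrix κ κ ℝ)))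
    (x : ι) :
    ∑ y, ∑ z, |∫ w, U' (matrixCLM A (WithLp.toLp 2 w) + ψ) (EuclideanSpace.single x (1 : ℝ)) *
            U'' (matrixCLM A (WithLp.toLp 2 w) + ψ) (EuclideanSpace.single y (1 : ℝ)) (EuclideanSpace.single z (1 : ℝ))
          ∂((volume : Measure (κ → ℝ)).tilted fun z => -(1 / 2 * (z ⬝ᵥ z) + U (matrixCLM A (WithLp.toLp 2 z) + ψ))) -
        (∫ w, U' (matrixCLM A (WithLp.toLp 2 w) + ψ) (EuclideanSpace.single x (1 : ℝ))
          ∂((volume : Measure (κ → ℝ)).tilted fun z => -(1 / 2 * (z ⬝ᵥ z) + U (matrixCLM A (WithLp.toLp 2 z) + ψ)))) *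
        (∫ w, U'' (matrixCLM A (WithLp.toLp 2 w) + ψ) (EuclideanSpace.single y (1 : ℝ)) (EuclideanSpace.single z (1 : ℝ))
          ∂((volume : Measure (κ → ℝ)).tilted fun z => -(1 / 2 * (z ⬝ᵥ z) + U (matrixCLM A (WithLp.toLp 2 z) + ψ))))| ≤
      hr * αr * (αc * k3c) * (1 - γ)⁻¹ * (1 - γ')⁻¹ / (1 - lamA) := by
  haveI : Nonempty ι := ⟨x⟩
  have hl1 : 0 < 1 - lamA := by linarith
  have hcpos : ∀ _x : κ, 0 < 1 - lamA := fun _ => hl1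
  -- Dobrushin's matrix (no precision part) and its Neumann series
  set Cm : Matrix κ κ ℝ := Matrix.of fun x w => (if w = x then 0 else ∑ u, ∑ v, |A u w| * |A v x| * Hk v u) / (1 - lamA) with hCm
  have hJ : ∀ x w : κ, 0 ≤ (if w = x then (0 : ℝ) else ∑ u, ∑ v, |A u w| * |A v x| * Hk v u) := fun x w => by
    split_ifs
    · exact le_rfl
    · exact whitened_cross_nonneg hHk0 A x w
  have hCmnn : ∀ x w, 0 ≤ Cm x w := fun x w => by rw [hCm, Matrix.of_apply]; exact div_nonneg (hJ x w) hl1.le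
  have hCmrow : ∀ x, ∑ w, Cm x w ≤ γ := fun x => by
    simp only [hCm, Matrix.of_apply]
    rw [← Finset.sum_div]
    refine le_trans (div_le_div_of_nonneg_right ?_ hl1.le) hγ
    refine le_trans (Finset.sum_le_sum fun w _ => ?_) (whitened_J_rowsum_le hHk0 hαr hαc hhr x)
    split_ifs
    · exact le_rfl
    · linarith [abs_nonneg ((1 : Matrix κ κ ℝ) x w)]
  have hCmcol : ∀ w, ∑ x, Cm x w ≤ γ' := fun w => by
    simp only [hCm, Matrix.of_apply]
    rw [← Finset.sum_div]
    refine le_trans (div_le_div_of_nonneg_right ?_ hl1.le) hγ'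
    refine le_trans (Finset.sum_le_sum fun x _ => ?_) (whitened_J_colsum_le hHk0 hαr hαc hhc w)
    split_ifs
    · exact le_rfl
    · linarith [abs_nonneg ((1 : Matrix κ κ ℝ) x w)]
  obtain ⟨w₀⟩ := ‹Nonempty κ›
  have hγ0 : 0 ≤ γ := (Finset.sum_nonneg fun z _ => hCmnn w₀ z).trans (hCmrow w₀)
  have hD : ∀ x y, 0 ≤ ∑' n : ℕ, (Cm ^ n) x y := neumann_nonneg hCmnn
  have hDC : ∀ x y, (if x = y then (1 : ℝ) else 0) + ∑ w, (∑' n : ℕ, (Cm ^ n) x w) *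
      ((if y = w then 0 else ∑ u, ∑ v, |A u y| * |A v w| * Hk v u) / (1 - lamA)) ≤ ∑' n : ℕ, (Cm ^ n) x y := by
    intro x y
    have h := neumann_dominates hCmnn hCmrow hγ0 hγ1 x y
    simp only [hCm, Matrix.of_apply] at h ⊢
    exact h
  have hDr : ∀ z, ∑ w, ∑' n : ℕ, (Cm ^ n) z w ≤ (1 - γ)⁻¹ := neumann_rowsum_le hCmnn hCmrow hγ0 hγ1
  have hDc : ∀ w, ∑ z, ∑' n : ℕ, (Cm ^ n) z w ≤ (1 - γ')⁻¹ := neumann_colsum_le hCmnn hCmrow hγ0 hγ1 hCmcol hγ'1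
  -- the moment letters in Lebesgue form
  have hV0 : Integrable (fun z : κ → ℝ => exp (-(1 / 2 * (z ⬝ᵥ z) + U (matrixCLM A (WithLp.toLp 2 z) + ψ)))) := by
    have h := whitened_integrable_lebesgue A ψ (k := fun _ => (1 : ℝ)) (by simpa only [mul_one] using hI0)
    simpa only [one_mul] using h
  have hV2 : ∀ w, Integrable (fun z : κ → ℝ => z w ^ 2 * exp (-(1 / 2 * (z ⬝ᵥ z) + U (matrixCLM A (WithLp.toLp 2 z) + ψ)))) := fun w => by
    have h := whitened_integrable_lebesgue A ψ (k := fun ξ : EuclideanSpace ℝ κ => ξ w ^ 2) (hI2 w)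
    simpa only [PiLp.toLp_apply] using h
  have hrow' : ∀ x : κ, ∑ w, (if w = x then (0 : ℝ) else ∑ u, ∑ v, |A u w| * |A v x| * Hk v u) / (1 - lamA) ≤ γ := fun x => by
    have h := hCmrow x
    simp only [hCm, Matrix.of_apply] at h
    exact h
  -- (447): `F_x` against the pair-indexed family `G_{yz}`
  have h := cov_rowsum_le_gibbs
    (P := fun x F ω => (∫ s, F (update ω x s) * exp (-(1 / 2 * (update ω x s ⬝ᵥ update ω x s) + U (matrixCLM A (WithLp.toLp 2 (update ω x s)) + ψ)))) /
      ∫ s, exp (-(1 / 2 * (update ω x s ⬝ᵥ update ω x s) + U (matrixCLM A (WithLp.toLp 2 (update ω x s)) + ψ))))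
    (D := fun x y => ∑' n : ℕ, (Cm ^ n) x y)
    (V := fun z => 1 / 2 * (z ⬝ᵥ z) + U (matrixCLM A (WithLp.toLp 2 z) + ψ))
    (V₁ := fun x z => z x + U' (matrixCLM A (WithLp.toLp 2 z) + ψ) (matrixCLM A (EuclideanSpace.single x (1 : ℝ))))
    (c := fun _ => 1 - lamA) (Cw := 1 + lamA) (J := fun x w => if w = x then 0 else ∑ u, ∑ v, |A u w| * |A v x| * Hk v u) (γ := γ)
    (F := fun w => U' (matrixCLM A (WithLp.toLp 2 w) + ψ) (EuclideanSpace.single x (1 : ℝ)))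
    (Gf := fun (p : ι × ι) w => U'' (matrixCLM A (WithLp.toLp 2 w) + ψ) (EuclideanSpace.single p.1 (1 : ℝ)) (EuclideanSpace.single p.2 (1 : ℝ)))
    (a := fun w => ∑ u, |A u w| * Hk x u) (bf := fun (p : ι × ι) w => ∑ u, |A u w| * K3 p.1 p.2 u)
    (dr := (1 - γ)⁻¹) (dc := (1 - γ')⁻¹) (cmin := 1 - lamA) (κc := αc * k3c) (Finset.univ : Finset (ι × ι))
    (fun _ _ _ => rfl) (fun x z => whitenedV_hasDerivAt hUd A ψ x z) (fun x z s t => whitenedV_floor hU'd hHk A hlam ψ x z s t) hcpos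
    (fun x z s t => whitenedV_ceiling hU'd hHk A hlam ψ x z s t)
    (fun x w hw z s t => by rw [if_neg hw]; exact whitenedV_cross hU'd hHk A ψ x w hw z s t)
    (whitenedV_continuous hUd A ψ) hV0 hV2 hJ (fun x => by simp) hrow' hγ0 hγ1 hD hDC hDr hDc hl1 (fun _ => le_rfl)
    (fun w z s t => whitened_obs_lipVec hU'd hHk A ψ x w z s t) (fun p w z' s t => hessian_obs_lipVec hU''d hK3 A ψ p.1 p.2 w z' s t)
    (fun w => hessian_family_colsum_le hK30 hαc hk3c w)
  refine le_trans (le_of_eq (pair_sum_eq _).symm) ?_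
  refine h.trans ?_
  have ha : ∑ w, ∑ u, |A u w| * Hk x u ≤ hr * αr := whitened_obs_rowsum_le hHk0 hαr hhr x
  obtain ⟨u₀⟩ := (⟨x⟩ : Nonempty ι)
  have hk3c0 : 0 ≤ k3c := le_trans (Finset.sum_nonneg fun y _ => Finset.sum_nonneg fun z _ => hK30 y z u₀) (hk3c u₀)
  have hκc0 : 0 ≤ αc * k3c := le_trans (Finset.sum_nonneg fun p _ => Finset.sum_nonneg fun u _ => mul_nonneg (abs_nonneg _) (hK30 p.1 p.2 u))
    (hessian_family_colsum_le hK30 hαc hk3c w₀)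
  have hγ'0 : 0 ≤ γ' := (Finset.sum_nonneg fun z _ => hCmnn z w₀).trans (hCmcol w₀)
  have hpos : 0 ≤ αc * k3c * (1 - γ)⁻¹ * (1 - γ')⁻¹ / (1 - lamA) := by
    have h1 : 0 < 1 - γ := by linarith
    have h2 : 0 < 1 - γ' := by linarith
    positivity
  calc (∑ w, ∑ u, |A u w| * Hk x u) * (αc * k3c) * (1 - γ)⁻¹ * (1 - γ')⁻¹ / (1 - lamA)
      = (∑ w, ∑ u, |A u w| * Hk x u) * (αc * k3c * (1 - γ)⁻¹ * (1 - γ')⁻¹ / (1 - lamA)) := by ring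
    _ ≤ hr * αr * (αc * k3c * (1 - γ)⁻¹ * (1 - γ')⁻¹ / (1 - lamA)) := mul_le_mul_of_nonneg_right ha hpos
    _ = hr * αr * (αc * k3c) * (1 - γ)⁻¹ * (1 - γ')⁻¹ / (1 - lamA) := by ring

/-! ## §3. THE END: the third two-point piece under `N(0, AAᵀ)` -/

/-- **THE THIRD TWO-POINT PIECE OF `∂³W`'S KERNEL LETTER UNDER `N(0,AAᵀ)`**: for the `C³` block class (`Hk`, `K3` majorants with their
letters), the factor's letters, the smallness and the two regulators (moment letters discharged by (458)),
`Σ_y Σ_z |Z⁻¹∫e^{−U}U′e_x·U″e_ye_z − Z⁻²(∫e^{−U}U′e_x)(∫e^{−U}U″e_ye_z)| ≤ (hr·αr)(αc·k3c)(1−γ)⁻¹(1−γ′)⁻¹∕(1−lamA)`. [folklore] -/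
theorem whitened_gradhess_cov_kernel_letter [Nonempty κ] (hΓop : (γop • (1 : Matrix ι ι ℝ) - A * Aᵀ).PosSemidef) (Y : Finset ι)
    (hUd : ∀ φ : EuclideanSpace ℝ ι, HasFDerivAt U (U' φ) φ) (hU'd : ∀ φ : EuclideanSpace ℝ ι, HasFDerivAt U' (U'' φ) φ)
    (hU''d : ∀ φ : EuclideanSpace ℝ ι, HasFDerivAt U'' (U₃ φ) φ)
    (hHk : ∀ (φ : EuclideanSpace ℝ ι) (x z : ι), |U'' φ (EuclideanSpace.single z (1 : ℝ)) (EuclideanSpace.single x (1 : ℝ))| ≤ Hk x z)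
    (hHk0 : ∀ v u, 0 ≤ Hk v u)
    (hK3 : ∀ (φ : EuclideanSpace ℝ ι) (u x y : ι),
      |U₃ φ (EuclideanSpace.single u (1 : ℝ)) (EuclideanSpace.single x (1 : ℝ)) (EuclideanSpace.single y (1 : ℝ))| ≤ K3 x y u)
    (hK30 : ∀ x y u, 0 ≤ K3 x y u) (hκ₀ : 0 ≤ κ₀) (hτ : 0 < τ) (hδ : 0 < δ) (hθ1 : θ < 1) (hκθ : 2 * κ₀ * (1 + τ) * γop ≤ θ)
    (hκθw : 2 * κ₀ * (1 + τ) * γop + 4 * δ ≤ θ) (hstab : ∀ φ : EuclideanSpace ℝ ι, -(κ₀ * ∑ x ∈ Y, φ x ^ 2) ≤ U φ) (ψ : EuclideanSpace ℝ ι)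
    (hαr : ∀ u, ∑ w, |A u w| ≤ αr) (hαc : ∀ w, ∑ u, |A u w| ≤ αc) (hhr : ∀ v, ∑ u, Hk v u ≤ hr) (hhc : ∀ u, ∑ v, Hk v u ≤ hc)
    (hk3c : ∀ u, ∑ y, ∑ z, K3 y z u ≤ k3c)
    (hlam : ∀ x : κ, ∑ u, ∑ v, |A u x| * |A v x| * Hk v u ≤ lamA) (hlam1 : lamA < 1)
    (hγ : αc * hr * αr / (1 - lamA) ≤ γ) (hγ1 : γ < 1) (hγ' : αc * hc * αr / (1 - lamA) ≤ γ') (hγ'1 : γ' < 1) (x : ι) :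
    ∑ y, ∑ z, |((∫ ω : EuclideanSpace ℝ ι, exp (-U (ω + ψ)) ∂(multivariateGaussian 0 (A * Aᵀ)))⁻¹ * (∫ ω : EuclideanSpace ℝ ι, exp (-U (ω + ψ)) *
          (U' (ω + ψ) (EuclideanSpace.single x (1 : ℝ)) * U'' (ω + ψ) (EuclideanSpace.single y (1 : ℝ)) (EuclideanSpace.single z (1 : ℝ)))
            ∂(multivariateGaussian 0 (A * Aᵀ))) - ((∫ ω : EuclideanSpace ℝ ι, exp (-U (ω + ψ)) ∂(multivariateGaussian 0 (A * Aᵀ))) ^ 2)⁻¹ *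
          ((∫ ω : EuclideanSpace ℝ ι, exp (-U (ω + ψ)) * U' (ω + ψ) (EuclideanSpace.single x (1 : ℝ)) ∂(multivariateGaussian 0 (A * Aᵀ))) *
            (∫ ω : EuclideanSpace ℝ ι, exp (-U (ω + ψ)) * U'' (ω + ψ) (EuclideanSpace.single y (1 : ℝ)) (EuclideanSpace.single z (1 : ℝ))
              ∂(multivariateGaussian 0 (A * Aᵀ)))))| ≤
      hr * αr * (αc * k3c) * (1 - γ)⁻¹ * (1 - γ')⁻¹ / (1 - lamA) := by
  haveI : Nonempty ι := ⟨x⟩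
  have hUc : Continuous U := continuous_iff_continuousAt.2 fun φ => (hUd φ).continuousAt
  have hU'c : Continuous U' := continuous_iff_continuousAt.2 fun φ => (hU'd φ).continuousAt
  have hU''c : Continuous U'' := continuous_iff_continuousAt.2 fun φ => (hU''d φ).continuousAt
  -- the moment letters ((458))
  have hI0 := whitened_exp_integrable hΓop Y hUc.measurable hκ₀ hτ hθ1 hκθ hstab ψ
  have hI2 := fun w => whitened_second_moment_integrable hΓop Y hUc.measurable hκ₀ hτ hδ hθ1 hκθw hstab ψ w
  have h := whitened_gradhess_cov_raw hUd hU'd hU''d hHk hHk0 hK3 hK30 A ψ hαr hαc hhr hhc hk3c hlam hlam1 hγ hγ1 hγ' hγ'1 hI0 hI2 x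
  -- measurability of the integrands (all continuous)
  have hsh : Continuous fun ω : EuclideanSpace ℝ ι => ω + ψ := continuous_id.add continuous_const
  have he : Continuous fun ω : EuclideanSpace ℝ ι => exp (-U (ω + ψ)) := continuous_exp.comp (hUc.comp hsh).neg
  have hg : Continuous fun ω : EuclideanSpace ℝ ι => U' (ω + ψ) (EuclideanSpace.single x (1 : ℝ)) := (hU'c.comp hsh).clm_apply continuous_const
  have hG : ∀ y z : ι, Continuous fun ω : EuclideanSpace ℝ ι => U'' (ω + ψ) (EuclideanSpace.single y (1 : ℝ)) (EuclideanSpace.single z (1 : ℝ)) := fun y z =>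
    ((hU''c.comp hsh).clm_apply continuous_const).clm_apply continuous_const
  have hm0 : AEStronglyMeasurable (fun ω : EuclideanSpace ℝ ι => exp (-U (ω + ψ))) (multivariateGaussian 0 (A * Aᵀ)) := he.aestronglyMeasurable
  have hm1 : AEStronglyMeasurable (fun ω : EuclideanSpace ℝ ι => exp (-U (ω + ψ)) * U' (ω + ψ) (EuclideanSpace.single x (1 : ℝ)))
      (multivariateGaussian 0 (A * Aᵀ)) := (he.mul hg).aestronglyMeasurable
  have hmG : ∀ y z : ι, AEStronglyMeasurable (fun ω : EuclideanSpace ℝ ι => exp (-U (ω + ψ)) * U'' (ω + ψ) (EuclideanSpace.single y (1 : ℝ))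
      (EuclideanSpace.single z (1 : ℝ))) (multivariateGaussian 0 (A * Aᵀ)) := fun y z => (he.mul (hG y z)).aestronglyMeasurable
  have hm2 : ∀ y z : ι, AEStronglyMeasurable (fun ω : EuclideanSpace ℝ ι => exp (-U (ω + ψ)) * (U' (ω + ψ) (EuclideanSpace.single x (1 : ℝ)) *
      U'' (ω + ψ) (EuclideanSpace.single y (1 : ℝ)) (EuclideanSpace.single z (1 : ℝ)))) (multivariateGaussian 0 (A * Aᵀ)) := fun y z =>
    (he.mul (hg.mul (hG y z))).aestronglyMeasurable
  refine le_trans (le_of_eq (Finset.sum_congr rfl fun y _ => Finset.sum_congr rfl fun z _ => ?_)) h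
  rw [whitened_tilted_eq_gauss A ψ, whitened_tilted_eq_gauss A ψ, whitened_tilted_eq_gauss A ψ]
  simp only [WithLp.toLp_ofLp]
  rw [whitened_integral_eq A hm0, whitened_integral_eq A (hm2 y z), whitened_integral_eq A hm1, whitened_integral_eq A (hmG y z)]
  congr 1
  ring

end Summit.QuantumFields.BalabanUV.T4Continuum.NE7b.SupWhitenedGradientHessianCovariance

end
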